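import Mathlib

/-!
# Registered stub (P) «PERIODIC ENTIRE RIGIDITY» of LINE g20-A «angular type» (planner ym-idea-3, crux ⟨stmt-QuantumFields-23035⟩
# `F4SubCurvatureDoor.ShortRootRigidity`; critic idea-crit-4 PASS/B+ 2026-08-29T10:11Z): an entire `π/3`-periodic function of
# little-o exponential type `6` is constant

Free-hands work of the LEAD seat ym-line-sfw-p2 (gen 74).  Classical one-variable complex analysis, the critic's second route:
with `h = π/3` and `q = 𝕢 h z = e^{6iz}` (Mathlib `Function.Periodic.qParam` / `cuspFunction`):

* `g := cuspFunction h G` is complex-differentiable at every `q ≠ 0` (`differentiableAt_cuspFunction`, `qParam_right_inv`);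
* since `Im (invQParam h q) = −log ‖q‖ / 6`, the hypothesis `‖G(φ + iψ)‖ ≤ δ e^{6|ψ|}` for `|ψ| ≥ Ψ(δ)` reads `‖G(invQParam h q)‖ ≤ δ/‖q‖`
  near `q = 0` and `≤ δ‖q‖` near `q = ∞`;
* so the singularity at `0` is removable (`Complex.differentiableOn_update_limUnder_of_isLittleO` — `cuspFunction` IS that update):
  `g` is ENTIRE, of growth `o(‖q‖)`;
* the Cauchy estimate `‖g′(a)‖ ≤ sup_{|q−a|=R} ‖g‖ / R` (`Complex.norm_deriv_le_of_forall_mem_sphere_norm_le`) with `R → ∞` and then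
  `δ → 0` gives `g′ ≡ 0`, hence `g` constant (`is_const_of_deriv_eq_zero`), hence `G = g ∘ 𝕢 h` constant (`eq_cuspFunction`).

The Prop `PeriodicEntireRigidity` is restated CHARACTER-FOR-CHARACTER from the registered skeleton
`Cruxes/ShortRootRigidity/Lines/angular_type.lean` (same namespace), so `stub_periodicEntireRigidity` closes the stub BY NAME.
HONEST LABEL: the classical stub of a PASSed line; the line's load-bearing stubs (C) `PlanarSpectralCone` (XL) and (A) are untouched;
no crux, rung, leaf or summit is proved; the Yang–Mills mass gap is NOT proved by this.
-/

noncomputable section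

namespace Summit.QuantumFields.YangMills.Cruxes.ShortRootRigidity.AngularType

open Complex Filter Set Metric Asymptotics Function
open scoped Topology Real

/-- «PERIODIC ENTIRE RIGIDITY» (classical, one complex variable): an entire `π/3`-periodic function of little-o exponential type `6`
is constant. [problem-side definition] -/
def PeriodicEntireRigidity : Prop :=
  ∀ G : ℂ → ℂ, Differentiable ℂ G → (∀ z : ℂ, G (z + ((Real.pi / 3 : ℝ) : ℂ)) = G z) →
    (∀ δ : ℝ, 0 < δ → ∃ Ψ : ℝ, ∀ φ ψ : ℝ, Ψ ≤ |ψ| → ‖G (φ + ψ * Complex.I)‖ ≤ δ * Real.exp (6 * |ψ|)) →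
    ∀ z w : ℂ, G z = G w

/-! ## The `q`-variable: `h = π/3`, `Im (invQParam h q) = −log ‖q‖ / 6` -/

/-- The period. -/
theorem period_pos : (0 : ℝ) < Real.pi / 3 := by positivity

/-- `Im (invQParam (π/3) q) = −log ‖q‖ / 6`. -/
theorem im_invQParam_eq (q : ℂ) : (Periodic.invQParam (Real.pi / 3) q).im = -(Real.log ‖q‖) / 6 := by
  rw [Periodic.im_invQParam]
  have hπ : Real.pi ≠ 0 := Real.pi_pos.ne'
  field_simp
  ring

/-- The growth hypothesis in the `q`-variable: `‖G(invQParam q)‖ ≤ δ·e^{|log ‖q‖|}` once `|log ‖q‖| ≥ 6Ψ` (`q ≠ 0`). -/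
theorem norm_comp_invQParam_le {G : ℂ → ℂ} {δ Ψ : ℝ}
    (hG : ∀ φ ψ : ℝ, Ψ ≤ |ψ| → ‖G (φ + ψ * Complex.I)‖ ≤ δ * Real.exp (6 * |ψ|))
    {q : ℂ} (hq : 6 * Ψ ≤ |Real.log ‖q‖|) :
    ‖G (Periodic.invQParam (Real.pi / 3) q)‖ ≤ δ * Real.exp |Real.log ‖q‖| := by
  set z := Periodic.invQParam (Real.pi / 3) q with hz
  have hψ : Ψ ≤ |z.im| := by
    rw [im_invQParam_eq, abs_div, abs_neg, abs_of_pos (by norm_num : (0:ℝ) < 6)]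
    linarith
  have h := hG z.re z.im hψ
  rw [Complex.re_add_im] at h
  have e6 : 6 * |z.im| = |Real.log ‖q‖| := by
    rw [im_invQParam_eq, abs_div, abs_neg, abs_of_pos (by norm_num : (0:ℝ) < 6)]
    ring
  rwa [e6] at h

/-! ## The stub -/

/-- ★ **Registered stub (P) BY NAME**: an entire `π/3`-periodic function of little-o exponential type `6` is constant. -/
theorem stub_periodicEntireRigidity : PeriodicEntireRigidity := by
  intro G hG hper hgrowth
  set h : ℝ := Real.pi / 3 with hh_def
  have hh : 0 < h := period_pos
  have hperiodic : Periodic G (h : ℂ) := fun z => hper z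
  -- the cusp function `g`
  set g : ℂ → ℂ := Periodic.cuspFunction h G with hg_def
  -- (1) `g` is differentiable away from `0`
  have hdiff_ne : ∀ q : ℂ, q ≠ 0 → DifferentiableAt ℂ g q := by
    intro q hq
    rw [hg_def, ← Periodic.qParam_right_inv hh.ne' hq]
    exact Periodic.differentiableAt_cuspFunction hh.ne' hperiodic (hG _)
  -- the raw composition agrees with `g` off `0`
  have hraw_eq : ∀ q : ℂ, q ≠ 0 → (G ∘ Periodic.invQParam h) q = g q := fun q hq => by
    rw [hg_def, Periodic.cuspFunction_eq_of_nonzero _ _ hq]; rfl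
  have hraw_diff : DifferentiableOn ℂ (G ∘ Periodic.invQParam h) (univ \ {0}) := by
    intro q hq
    have hq0 : q ≠ 0 := by simpa using hq
    have hev : (G ∘ Periodic.invQParam h) =ᶠ[𝓝 q] g := by
      filter_upwards [isOpen_ne.mem_nhds hq0] with q' hq'
      exact hraw_eq q' hq'
    exact ((hdiff_ne q hq0).congr_of_eventuallyEq hev).differentiableWithinAt
  -- (2) growth near `0`: `G ∘ invQParam = o(q⁻¹)`, hence the singularity is removable
  have hsmallO : (fun q => (G ∘ Periodic.invQParam h) q - (G ∘ Periodic.invQParam h) 0) =o[𝓝[≠] (0:ℂ)]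
      fun q => (q - 0)⁻¹ := by
    simp only [sub_zero]
    have h1 : (fun q => (G ∘ Periodic.invQParam h) q) =o[𝓝[≠] (0:ℂ)] fun q : ℂ => q⁻¹ := by
      refine isLittleO_iff.2 fun δ hδ => ?_
      obtain ⟨Ψ, hΨ⟩ := hgrowth δ hδ
      -- for `0 < ‖q‖ ≤ min 1 (exp (-(6 Ψ)))` we have `|log ‖q‖| = -log ‖q‖ ≥ 6Ψ` and `exp |log ‖q‖| = ‖q‖⁻¹`
      have hmem : {q : ℂ | q ≠ 0 ∧ ‖q‖ < min 1 (Real.exp (-(6 * |Ψ|)))} ∈ 𝓝[≠] (0:ℂ) := by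
        have hr : 0 < min 1 (Real.exp (-(6 * |Ψ|))) := lt_min one_pos (Real.exp_pos _)
        have : ball (0:ℂ) (min 1 (Real.exp (-(6 * |Ψ|)))) ∈ 𝓝 (0:ℂ) := ball_mem_nhds _ hr
        filter_upwards [self_mem_nhdsWithin, mem_nhdsWithin_of_mem_nhds this] with q hq hq'
        exact ⟨hq, by simpa using hq'⟩
      filter_upwards [hmem] with q hq
      obtain ⟨hq0, hqr⟩ := hq
      have hqpos : 0 < ‖q‖ := norm_pos_iff.2 hq0
      have hq1 : ‖q‖ < 1 := lt_of_lt_of_le hqr (min_le_left _ _)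
      have hqe : ‖q‖ < Real.exp (-(6 * |Ψ|)) := lt_of_lt_of_le hqr (min_le_right _ _)
      have hlogneg : Real.log ‖q‖ < 0 := Real.log_neg hqpos hq1
      have hlog : Real.log ‖q‖ < -(6 * |Ψ|) := by
        rw [← Real.exp_lt_exp, Real.exp_log hqpos]; exact hqe
      have habs : |Real.log ‖q‖| = -Real.log ‖q‖ := abs_of_neg hlogneg
      have hΨ' : 6 * Ψ ≤ |Real.log ‖q‖| := by rw [habs]; linarith [le_abs_self Ψ]
      have hb := norm_comp_invQParam_le hΨ hΨ'
      rw [habs, Real.exp_neg, Real.exp_log hqpos] at hb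
      simpa [norm_inv] using hb
    have h2 : (fun _ : ℂ => (G ∘ Periodic.invQParam h) 0) =o[𝓝[≠] (0:ℂ)] fun q : ℂ => q⁻¹ := by
      refine isLittleO_const_left.2 (Or.inr ?_)
      have ht : Tendsto (fun q : ℂ => ‖q‖⁻¹) (𝓝[≠] (0:ℂ)) atTop :=
        (tendsto_norm_nhdsNE_zero (E := ℂ)).inv_tendsto_nhdsGT_zero
      refine ht.congr' (Eventually.of_forall fun q => ?_)
      simp [norm_inv]
    exact h1.sub h2
  have hentire : Differentiable ℂ g := by
    have := Complex.differentiableOn_update_limUnder_of_isLittleO (univ_mem : (univ : Set ℂ) ∈ 𝓝 (0:ℂ))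
      hraw_diff hsmallO
    -- `cuspFunction` is exactly this `update`
    have hupd : update (G ∘ Periodic.invQParam h) 0 (limUnder (𝓝[≠] (0:ℂ)) (G ∘ Periodic.invQParam h)) = g := rfl
    rw [hupd] at this
    exact fun q => (this q (mem_univ q)).differentiableAt univ_mem
  -- (3) growth at `∞`: `‖g q‖ ≤ δ ‖q‖` for `‖q‖ ≥ max 1 (exp (6|Ψ|))`
  have hlarge : ∀ δ : ℝ, 0 < δ → ∃ R₀ : ℝ, 0 < R₀ ∧ ∀ q : ℂ, R₀ ≤ ‖q‖ → ‖g q‖ ≤ δ * ‖q‖ := by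
    intro δ hδ
    obtain ⟨Ψ, hΨ⟩ := hgrowth δ hδ
    refine ⟨max 1 (Real.exp (6 * |Ψ|)), lt_max_of_lt_left one_pos, fun q hq => ?_⟩
    have hq1 : 1 ≤ ‖q‖ := le_trans (le_max_left _ _) hq
    have hqpos : 0 < ‖q‖ := lt_of_lt_of_le one_pos hq1
    have hq0 : q ≠ 0 := norm_pos_iff.1 hqpos
    have hlog0 : 0 ≤ Real.log ‖q‖ := Real.log_nonneg hq1
    have hlog : 6 * |Ψ| ≤ Real.log ‖q‖ := by
      rw [← Real.exp_le_exp, Real.exp_log hqpos]; exact le_trans (le_max_right _ _) hq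
    have habs : |Real.log ‖q‖| = Real.log ‖q‖ := abs_of_nonneg hlog0
    have hΨ' : 6 * Ψ ≤ |Real.log ‖q‖| := by rw [habs]; linarith [le_abs_self Ψ]
    have hb := norm_comp_invQParam_le hΨ hΨ'
    rw [habs, Real.exp_log hqpos] at hb
    rw [← hraw_eq q hq0]
    exact hb
  -- (4) `g′ ≡ 0` by the Cauchy estimate on large circles
  have hderiv : ∀ a : ℂ, deriv g a = 0 := by
    intro a
    rw [← norm_eq_zero]
    refine le_antisymm (le_of_forall_pos_le_add fun ε hε => ?_) (norm_nonneg _)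
    -- take δ = ε/2 and R ≥ max R₀ ‖a‖ + ‖a‖ + 1
    obtain ⟨R₀, hR₀, hgR⟩ := hlarge (ε / 2) (by positivity)
    set R : ℝ := R₀ + 2 * ‖a‖ + 1 with hR_def
    have hRpos : 0 < R := by rw [hR_def]; positivity
    have hsph : ∀ q ∈ sphere a R, ‖g q‖ ≤ ε / 2 * (R + ‖a‖) := by
      intro q hq
      rw [mem_sphere, dist_eq_norm] at hq
      have hqa : ‖q‖ ≤ R + ‖a‖ := by
        calc ‖q‖ = ‖(q - a) + a‖ := by rw [sub_add_cancel]
          _ ≤ ‖q - a‖ + ‖a‖ := norm_add_le _ _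
          _ = R + ‖a‖ := by rw [hq]
      have hqR : R₀ ≤ ‖q‖ := by
        have : R - ‖a‖ ≤ ‖q‖ := by
          have hs := norm_sub_le q a
          linarith
        rw [hR_def] at this; linarith [norm_nonneg a]
      exact (hgR q hqR).trans (mul_le_mul_of_nonneg_left hqa (by positivity))
    have hC := Complex.norm_deriv_le_of_forall_mem_sphere_norm_le hRpos hentire.diffContOnCl hsph
    have : ε / 2 * (R + ‖a‖) / R ≤ ε := by
      rw [div_le_iff₀ hRpos]
      have : ‖a‖ ≤ R := by rw [hR_def]; linarith [norm_nonneg a]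
      nlinarith
    linarith [norm_nonneg (deriv g a)]
  have hconst := is_const_of_deriv_eq_zero hentire hderiv
  -- (5) conclude through `G = g ∘ 𝕢 h`
  intro z w
  rw [← Periodic.eq_cuspFunction hh.ne' hperiodic z, ← Periodic.eq_cuspFunction hh.ne' hperiodic w]
  exact hconst _ _

end Summit.QuantumFields.YangMills.Cruxes.ShortRootRigidity.AngularType

end
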